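import Summits.PneNP.PneNP.Theorems.SymmetryBudgetNoHiddenOrderProgramRankB
import Summits.PneNP.PneNP.Theorems.SymmetryBudgetNoHiddenOrderValueAndDefs
import Summits.PneNP.PneNP.Theorems.SymmetryBudgetNoHiddenOrderFLabOfLab

/-!
# `NoHiddenOrder` (stmt-PneNP-14781), (R2c) VI: the window canoniser program — ranks III: wire facts and the value shapes

Route `PneNP/SymmetryBudget`; continues `SymmetryBudgetNoHiddenOrderProgramRankB.lean`.  The `Pre` facts of the concrete wires — state wires
`memW/valW/consW/deadW` (root data or the previous transition), adjacency, analysis gates, and the EXTERNAL wires of candidate / part labels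
(labels of smaller `measure`, by `measure_cand_lt` / `measure_part_lt`) —, and that every source of a value gate (`pre_orSrcs`, `pre_andSrcs`,
`pre_vlSrcs`) is `Pre` at the gate's coordinates.  Supports stmt-PneNP-14781.
-/

set_option linter.dupNamespace false -- `Summit.PneNP.PneNP.…` (D-0017 single-conjunct layout)

namespace Summit.PneNP.PneNP.Theorems

open Finset CGBits BranchSum Literature.Computability.Complexity Literature.Computability.Complexity.SymProg

namespace WCanon.R2c

variable {m : ℕ}

/-! ### Wire facts -/

/-- The measure of (the label denoted by) an admissible label. -/
abbrev msL (L : FLab m) : ℕ := (toLab L).measure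

/-- State membership wires are root data or the previous transition. [folklore] -/
theorem pre_memW (L : FLab m) (k : Fin (pF m + 1)) (v : WV m) {b lv : ℕ} (hb : 2 * (k : ℕ) ≤ b) : Pre 1 (msL L) b lv (memW L k v) := by
  unfold memW; split_ifs with h
  · exact pre_tier (by simp [tier])
  · exact pre_blk rfl rfl (by simp only [blk]; omega)

/-- State value wires are root data or the previous transition. [folklore] -/
theorem pre_valW (L : FLab m) (k : Fin (pF m + 1)) (v : WV m) (c : Fin (wn m)) {b lv : ℕ} (hb : 2 * (k : ℕ) ≤ b) :
    Pre 1 (msL L) b lv (valW L k v c) := by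
  unfold valW; split_ifs with h
  · exact pre_tier (by simp [tier])
  · exact pre_blk rfl rfl (by simp only [blk]; omega)

/-- State consumed wires are root data or the previous transition. [folklore] -/
theorem pre_consW (L : FLab m) (k : Fin (pF m + 1)) (v : WV m) {b lv : ℕ} (hb : 2 * (k : ℕ) ≤ b) : Pre 1 (msL L) b lv (consW L k v) := by
  unfold consW; split_ifs with h
  · exact pre_tier (by simp [tier])
  · exact pre_blk rfl rfl (by simp only [blk]; omega)

/-- State dead wires are root data or the previous transition. [folklore] -/
theorem pre_deadW (L : FLab m) (k : Fin (pF m + 1)) {b lv : ℕ} (hb : 2 * (k : ℕ) ≤ b) : Pre 1 (msL L) b lv (deadW L k) := by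
  unfold deadW; split_ifs with h
  · exact pre_tier (by simp [tier])
  · exact pre_blk rfl rfl (by simp only [blk]; omega)

/-- Adjacency wires are root data. -/
theorem pre_adjWire (u v : WV m) {s b lv : ℕ} : Pre 1 s b lv (adjWire u v) := pre_tier (by simp [tier])

/-- Analysis gates of stage `k` sit in block `2k`. -/
theorem pre_an (L : FLab m) (k : Fin (pF m + 1)) (g : AnGate m) {b lv : ℕ} (hb : 2 * (k : ℕ) < b) :
    Pre 1 (msL L) b lv (Sum.inr (.an L k g)) :=
  pre_blk rfl rfl (by simp only [blk]; omega)

/-- A candidate label has smaller measure. [folklore] -/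
theorem ms_candLab {L Lc : FLab m} {κ : WV m × Fin (wn m)} (h : candLab L κ = some Lc) : msL Lc < msL L := by
  unfold candLab at h
  split_ifs at h with hx
  unfold msL; rw [toLab_ofLab h]
  exact CertifiedLabels.Label.measure_cand_lt _ hx _

/-- A part label has smaller measure. [folklore] -/
theorem ms_partLab {L Lp : FLab m} {U' : Finset (WV m)} (h : partLab L U' = some Lp) : msL Lp < msL L := by
  unfold partLab at h
  split_ifs at h with hU
  unfold msL; rw [toLab_ofLab h]
  refine CertifiedLabels.Label.measure_part_lt _ ?_
  simp only [partSets, mem_filter, mem_powerset] at hU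
  exact lt_of_le_of_ne hU.1 hU.2.2

/-- External wire fact. -/
theorem pre_cdOKW (L : FLab m) (κ : WV m × Fin (wn m)) {b lv : ℕ} : Pre 1 (msL L) b lv (cdOKW L κ) := by
  unfold cdOKW; split
  · exact pre_ms rfl (ms_candLab ‹_›)
  · exact pre_tier (by simp [tier])

/-- External wire fact. -/
theorem pre_cdValW (L : FLab m) (κ : WV m × Fin (wn m)) (w : WV m) (c : Fin (wn m)) {b lv : ℕ} : Pre 1 (msL L) b lv (cdValW L κ w c) := by
  unfold cdValW; split
  · rename_i Lc h
    unfold valW; split_ifs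
    · exact pre_tier (by simp [tier])
    · exact pre_ms rfl (ms_candLab h)
  · exact pre_tier (by simp [tier])

/-- External wire fact. -/
theorem pre_cdOkW (L : FLab m) (κ : WV m × Fin (wn m)) {b lv : ℕ} : Pre 1 (msL L) b lv (cdOkW L κ) := by
  unfold cdOkW; split
  · exact pre_ms rfl (ms_candLab ‹_›)
  · exact pre_tier (by simp [tier])

/-- External wire fact. -/
theorem pre_cdBitW (L : FLab m) (κ : WV m × Fin (wn m)) (bb : Fin (NB (wn m))) {b lv : ℕ} : Pre 1 (msL L) b lv (cdBitW L κ bb) := by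
  unfold cdBitW; split
  · exact pre_ms rfl (ms_candLab ‹_›)
  · exact pre_tier (by simp [tier])

/-- External wire fact. -/
theorem pre_ptOkW (L : FLab m) (U' : Finset (WV m)) {b lv : ℕ} : Pre 1 (msL L) b lv (ptOkW L U') := by
  unfold ptOkW; split
  · exact pre_ms rfl (ms_partLab ‹_›)
  · exact pre_tier (by simp [tier])

/-- External wire fact. -/
theorem pre_ptBitW (L : FLab m) (U' : Finset (WV m)) (bb : Fin (NB (wn m))) {b lv : ℕ} : Pre 1 (msL L) b lv (ptBitW L U' bb) := by
  unfold ptBitW; split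
  · exact pre_ms rfl (ms_partLab ‹_›)
  · exact pre_tier (by simp [tier])

/-- The lifted value wire of a candidate: an own `liftC` gate or an external bit. -/
theorem pre_orLW (L : FLab m) (κ : WV m × Fin (wn m)) (bb : Fin (NB (wn m))) {lv : ℕ} (hlv : 12 * wn m + 11 ≤ lv) :
    Pre 1 (msL L) (2 * pF m + 2) lv (orLW L κ bb) := by
  unfold orLW liftWire; split
  · exact pre_gate rfl rfl rfl (by simp only [lvl, orLvl]; omega)
  · exact pre_cdBitW L κ _

/-! ### The value shapes -/

/-- The last stage is below the value blocks. -/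
theorem two_kF_lt (m : ℕ) : 2 * ((kF m : Fin (pF m + 1)) : ℕ) < 2 * pF m + 2 := by simp [Fin.val_last]

/-- Sources of a value gate at an individualisation node. [folklore] -/
theorem pre_orSrcs (L : FLab m) (g : OrGate m) : ∀ w ∈ orSrcs L g, Pre 1 (msL L) (2 * pF m + 2) (orLvl g) w := by
  have own : ∀ g g' : OrGate m, orLvl g' < orLvl g → Pre 1 (msL L) (2 * pF m + 2) (orLvl g) (Sum.inr (Gt.vor L g')) :=
    fun g g' h => pre_gate rfl rfl rfl (by simpa only [lvl] using h)
  have han : ∀ (g' : AnGate m) {lv : ℕ}, Pre 1 (msL L) (2 * pF m + 2) lv (Sum.inr (Gt.an L (kF m) g')) :=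
    fun g' => pre_an L _ g' (two_kF_lt m)
  have hmem : ∀ (v : WV m) {lv : ℕ}, Pre 1 (msL L) (2 * pF m + 2) lv (memW L (kF m) v) :=
    fun v => pre_memW L _ v (two_kF_lt m).le
  have hval : ∀ (v : WV m) (c : Fin (wn m)) {lv : ℕ}, Pre 1 (msL L) (2 * pF m + 2) lv (valW L (kF m) v c) :=
    fun v c => pre_valW L _ v c (two_kF_lt m).le
  cases g with
  | ltx y u v =>
    simp only [orSrcs]
    split_ifs
    · simp only [Finset.forall_mem_insert, Finset.mem_singleton, forall_eq]; exact ⟨han _, han _⟩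
    · simp only [Finset.mem_singleton, forall_eq]; exact han _
  | eqx y u v =>
    simp only [orSrcs]
    split_ifs
    · simp only [Finset.mem_singleton, forall_eq]; exact han _
    · simp only [Finset.mem_singleton, forall_eq]; exact pre_tier (by simp [tier])
  | rv y g =>
    simp only [orSrcs, orLvl]
    refine fun w' hw' =>
      (pre_riSrcs (ι := orRIIn L y) (base := 1) (fun v => hmem v) (fun u v => pre_adjWire u v)
        (fun u v => own (.rv y (.nmem u)) (.ltx y u v) (by simp [orLvl, riLvl]))
        (fun u v => own (.rv y (.nmem u)) (.eqx y u v) (by simp [orLvl, riLvl]))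
        (fun g' => pre_gate rfl rfl rfl (by simp only [lvl, orLvl]; omega)) g w' hw').of_le le_rfl
  | bothc κ w c =>
    simp only [orSrcs, Finset.forall_mem_insert, Finset.mem_singleton, forall_eq]
    exact ⟨pre_cdValW L κ w c, own _ _ (by simp only [orLvl]; have := riLvl_lt (RIGate.vval w c : RIGate m); omega)⟩
  | nonec κ w c =>
    simp only [orSrcs, Finset.forall_mem_insert, Finset.mem_singleton, forall_eq]
    exact ⟨pre_cdValW L κ w c, own _ _ (by simp only [orLvl]; have := riLvl_lt (RIGate.vval w c : RIGate m); omega)⟩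
  | xnc κ w c =>
    simp only [orSrcs, Finset.forall_mem_insert, Finset.mem_singleton, forall_eq]
    exact ⟨own _ _ (by simp only [orLvl]; omega), own _ _ (by simp only [orLvl]; omega)⟩
  | eqc κ =>
    simp only [orSrcs, Finset.forall_mem_insert, Finset.forall_mem_image, Finset.mem_univ, true_imp_iff]
    exact ⟨pre_cdOKW L κ, fun wc => own _ _ (by simp only [orLvl]; omega)⟩
  | kept κ =>
    simp only [orSrcs]
    split_ifs
    · simp only [Finset.forall_mem_insert, Finset.mem_singleton, forall_eq]
      exact ⟨han _, own _ _ (by simp only [orLvl]; omega), pre_cdOkW L κ⟩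
    · simp
  | cmu y c' c u =>
    simp only [orSrcs, Finset.forall_mem_insert, Finset.mem_singleton, forall_eq]
    exact ⟨hmem _, own _ _ (by simp only [orLvl]; have := riLvl_lt (RIGate.vval u c' : RIGate m); omega), hval _ _⟩
  | cm y c' c =>
    simp only [orSrcs, Finset.forall_mem_image, Finset.mem_univ, true_imp_iff]
    exact fun u => own _ _ (by simp only [orLvl]; omega)
  | lc κ i c' c =>
    simp only [orSrcs, Finset.forall_mem_insert, Finset.mem_singleton, forall_eq]
    exact ⟨pre_cdBitW L κ _, own _ _ (by simp only [orLvl]; omega)⟩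
  | liftC κ i c =>
    simp only [orSrcs, Finset.forall_mem_image, Finset.mem_univ, true_imp_iff]
    exact fun c' => own _ _ (by simp only [orLvl]; omega)
  | vc g =>
    simp only [orSrcs, orLvl]
    exact pre_voSrcs (base := 12 * wn m + 11) (fun κ bb => pre_orLW L κ bb le_rfl)
      (fun g' => pre_gate rfl rfl rfl (by simp only [lvl, orLvl]; omega)) g
  | beat κ' κ =>
    simp only [orSrcs, Finset.forall_mem_insert, Finset.mem_singleton, forall_eq]
    exact ⟨own _ _ (by simp only [orLvl]; omega), own _ _ (by simp only [orLvl, voLvl]; omega)⟩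
  | nbeat κ' κ =>
    simp only [orSrcs, Finset.mem_singleton, forall_eq]
    exact own _ _ (by simp only [orLvl]; omega)
  | best κ =>
    simp only [orSrcs, Finset.forall_mem_insert, Finset.forall_mem_image, Finset.mem_univ, true_imp_iff]
    exact ⟨own _ _ (by simp only [orLvl]; omega), fun κ' => own _ _ (by simp only [orLvl]; omega)⟩
  | orOk =>
    simp only [orSrcs, Finset.forall_mem_image, Finset.mem_univ, true_imp_iff]
    exact fun κ => own _ _ (by simp only [orLvl]; omega)
  | ob κ bb =>
    simp only [orSrcs, Finset.forall_mem_insert, Finset.mem_singleton, forall_eq]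
    exact ⟨own _ _ (by simp only [orLvl]; omega), pre_orLW L κ bb (by simp only [orLvl]; omega)⟩
  | orBit bb =>
    simp only [orSrcs, Finset.forall_mem_image, Finset.mem_univ, true_imp_iff]
    exact fun κ => own _ _ (by simp only [orLvl]; omega)

/-- Sources of a value gate at a section node. [folklore] -/
theorem pre_andSrcs (L : FLab m) (g : AndGate m) : ∀ w ∈ andSrcs L g, Pre 1 (msL L) (2 * pF m + 2) (andLvl g) w := by
  have own : ∀ g g' : AndGate m, andLvl g' < andLvl g → Pre 1 (msL L) (2 * pF m + 2) (andLvl g) (Sum.inr (Gt.vand L g')) :=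
    fun g g' h => pre_gate rfl rfl rfl (by simpa only [lvl] using h)
  have han : ∀ (g' : AnGate m) {lv : ℕ}, Pre 1 (msL L) (2 * pF m + 2) lv (Sum.inr (Gt.an L (kF m) g')) :=
    fun g' => pre_an L _ g' (two_kF_lt m)
  have hmem : ∀ (v : WV m) {lv : ℕ}, Pre 1 (msL L) (2 * pF m + 2) lv (memW L (kF m) v) :=
    fun v => pre_memW L _ v (two_kF_lt m).le
  have hval : ∀ (v : WV m) (c : Fin (wn m)) {lv : ℕ}, Pre 1 (msL L) (2 * pF m + 2) lv (valW L (kF m) v c) :=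
    fun v c => pre_valW L _ v c (two_kF_lt m).le
  cases g with
  | nreach u w =>
    simp only [andSrcs, Finset.mem_singleton, forall_eq]; exact han _
  | partAt u U' =>
    simp only [andSrcs, Finset.forall_mem_union, Finset.forall_mem_image]
    exact ⟨fun w _ => han _, fun w _ => own _ _ (by simp only [andLvl]; omega)⟩
  | isPart U' =>
    simp only [andSrcs]
    split_ifs
    · simp only [Finset.forall_mem_image]; exact fun u _ => own _ _ (by simp only [andLvl]; omega)
    · simp
  | nisPart U' =>
    simp only [andSrcs, Finset.mem_singleton, forall_eq]; exact own _ _ (by simp only [andLvl]; omega)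
  | imp U' =>
    simp only [andSrcs, Finset.forall_mem_insert, Finset.mem_singleton, forall_eq]
    exact ⟨own _ _ (by simp only [andLvl]; omega), pre_ptOkW L U'⟩
  | andOk =>
    simp only [andSrcs, Finset.forall_mem_image]; exact fun U' _ => own _ _ (by simp only [andLvl]; omega)
  | vc g =>
    simp only [andSrcs, andLvl]
    have h := pre_vaSrcs (t := 1) (s := msL L) (b := 2 * pF m + 2) (base := 0) (bw := ptBitW L) (e := fun g' => Gt.vand L (.vc g'))
      (fun U' bb => pre_ptBitW L U' bb) (fun g' => pre_gate rfl rfl rfl (by simp only [lvl, andLvl]; omega)) g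
    simpa only [Nat.zero_add] using h
  | pg U' U'' u =>
    simp only [andSrcs]
    split_ifs
    · simp only [Finset.forall_mem_insert, Finset.mem_singleton, forall_eq]
      exact ⟨own _ _ (by simp only [andLvl]; omega), own _ _ (by simp only [andLvl, vaLvl]; omega)⟩
    · simp
  | cntGe U' t' =>
    simp only [andSrcs, Finset.forall_mem_image]; exact fun Uu _ => own _ _ (by simp only [andLvl]; omega)
  | ncntGe U' t' =>
    simp only [andSrcs, Finset.mem_singleton, forall_eq]; exact own _ _ (by simp only [andLvl]; omega)
  | cntIs U' t' =>
    simp only [andSrcs, Finset.forall_mem_insert, Finset.mem_singleton, forall_eq]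
    exact ⟨own _ _ (by simp only [andLvl]; omega), own _ _ (by simp only [andLvl]; omega)⟩
  | eqp U' U'' =>
    simp only [andSrcs, Finset.forall_mem_insert, Finset.mem_singleton, forall_eq]
    exact ⟨own _ _ (by simp only [andLvl]; omega), own _ _ (by simp only [andLvl, vaLvl]; omega)⟩
  | multGe U' q =>
    simp only [andSrcs, Finset.forall_mem_image]; exact fun U'' _ => own _ _ (by simp only [andLvl]; omega)
  | rowSrc i U' t' =>
    simp only [andSrcs]
    split_ifs
    · simp only [Finset.forall_mem_insert, Finset.mem_singleton, forall_eq]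
      exact ⟨own _ _ (by simp only [andLvl]; omega), own _ _ (by simp only [andLvl]; omega), own _ _ (by simp only [andLvl]; omega)⟩
    · simp
  | pcb i c U' t' o =>
    simp only [andSrcs]
    split_ifs
    · simp only [Finset.forall_mem_insert, Finset.mem_singleton, forall_eq]
      exact ⟨own _ _ (by simp only [andLvl]; omega), pre_ptBitW L U' _⟩
    · simp
  | pCol i c =>
    simp only [andSrcs, Finset.forall_mem_image]; exact fun z _ => own _ _ (by simp only [andLvl]; omega)
  | scp i j U' t' =>
    simp only [andSrcs]
    split_ifs
    · simp only [Finset.forall_mem_insert, Finset.mem_singleton, forall_eq]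
      exact ⟨own _ _ (by simp only [andLvl]; omega), own _ _ (by simp only [andLvl]; omega), own _ _ (by simp only [andLvl]; omega)⟩
    · simp
  | sameCopy i j =>
    simp only [andSrcs, Finset.forall_mem_image]; exact fun z _ => own _ _ (by simp only [andLvl]; omega)
  | nsame i j =>
    simp only [andSrcs, Finset.mem_singleton, forall_eq]; exact own _ _ (by simp only [andLvl]; omega)
  | pab i j U' t' o o' =>
    simp only [andSrcs]
    split_ifs
    · simp only [Finset.forall_mem_insert, Finset.mem_singleton, forall_eq]
      exact ⟨own _ _ (by simp only [andLvl]; omega), pre_ptBitW L U' _⟩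
    · simp
  | pOwn i j =>
    simp only [andSrcs, Finset.forall_mem_image]; exact fun z _ => own _ _ (by simp only [andLvl]; omega)
  | swu c c' u w =>
    simp only [andSrcs, Finset.forall_mem_insert, Finset.mem_singleton, forall_eq]
    exact ⟨hmem _, hmem _, hval _ _, hval _ _, han _⟩
  | swcc c c' =>
    simp only [andSrcs, Finset.forall_mem_image, Finset.mem_univ, true_imp_iff]; exact fun uw => own _ _ (by simp only [andLvl]; omega)
  | xcp i j c c' =>
    simp only [andSrcs, Finset.forall_mem_insert, Finset.mem_singleton, forall_eq]
    exact ⟨own _ _ (by simp only [andLvl]; omega), own _ _ (by simp only [andLvl]; omega), own _ _ (by simp only [andLvl]; omega)⟩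
  | xc i j =>
    simp only [andSrcs, Finset.forall_mem_image, Finset.mem_univ, true_imp_iff]; exact fun cc => own _ _ (by simp only [andLvl]; omega)
  | pX i j =>
    simp only [andSrcs, Finset.forall_mem_insert, Finset.mem_singleton, forall_eq]
    exact ⟨own _ _ (by simp only [andLvl]; omega), own _ _ (by simp only [andLvl]; omega)⟩
  | pAdj i j =>
    simp only [andSrcs, Finset.forall_mem_insert, Finset.mem_singleton, forall_eq]
    exact ⟨own _ _ (by simp only [andLvl]; omega), own _ _ (by simp only [andLvl]; omega)⟩

/-- Sources of an output gate of a value. [folklore] -/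
theorem pre_vlSrcs (L : FLab m) (g : VlGate m) : ∀ w ∈ vlSrcs L g, Pre 1 (msL L) (2 * pF m + 3) (vlLvl g) w := by
  have own : ∀ g g' : VlGate m, vlLvl g' < vlLvl g → Pre 1 (msL L) (2 * pF m + 3) (vlLvl g) (Sum.inr (Gt.vl L g')) :=
    fun g g' h => pre_gate rfl rfl rfl (by simpa only [lvl] using h)
  have han : ∀ (g' : AnGate m) {lv : ℕ}, Pre 1 (msL L) (2 * pF m + 3) lv (Sum.inr (Gt.an L (kF m) g')) :=
    fun g' => pre_an L _ g' (by simp only [Fin.val_last]; omega)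
  have hor : ∀ (g' : OrGate m) {lv : ℕ}, Pre 1 (msL L) (2 * pF m + 3) lv (Sum.inr (Gt.vor L g')) :=
    fun g' => pre_blk rfl rfl (by simp only [blk]; omega)
  have hand : ∀ (g' : AndGate m) {lv : ℕ}, Pre 1 (msL L) (2 * pF m + 3) lv (Sum.inr (Gt.vand L g')) :=
    fun g' => pre_blk rfl rfl (by simp only [blk]; omega)
  have hff : ∀ {lv : ℕ}, Pre 1 (msL L) (2 * pF m + 3) lv (Sum.inr Gt.ff : Wire m) := pre_tier (by simp [tier])
  cases g with
  | ndead =>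
    simp only [vlSrcs, Finset.mem_singleton, forall_eq]
    exact pre_deadW L _ (by simp only [Fin.val_last]; omega)
  | decOK =>
    simp only [vlSrcs, Finset.forall_mem_insert, Finset.mem_singleton, forall_eq]
    exact ⟨han _, own _ _ (by simp only [vlLvl]; omega)⟩
  | a1 =>
    simp only [vlSrcs, Finset.forall_mem_insert, Finset.mem_singleton, forall_eq]; exact ⟨han _, hand _⟩
  | a2 =>
    simp only [vlSrcs, Finset.forall_mem_insert, Finset.mem_singleton, forall_eq]; exact ⟨han _, hor _⟩
  | okk =>
    simp only [vlSrcs, Finset.forall_mem_insert, Finset.mem_singleton, forall_eq]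
    exact ⟨own _ _ (by simp only [vlLvl]; omega), own _ _ (by simp only [vlLvl]; omega)⟩
  | ok =>
    simp only [vlSrcs]
    split_ifs
    · simp only [Finset.mem_singleton, forall_eq]; exact own _ _ (by simp only [vlLvl]; omega)
    · simp only [Finset.forall_mem_insert, Finset.mem_singleton, forall_eq]
      exact ⟨own _ _ (by simp only [vlLvl]; omega), own _ _ (by simp only [vlLvl]; omega)⟩
  | b1 bb =>
    simp only [vlSrcs, Finset.forall_mem_insert, Finset.mem_singleton, forall_eq]
    refine ⟨han _, hand _, ?_⟩
    unfold awW; split <;> exact hand _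
  | b2 bb =>
    simp only [vlSrcs, Finset.forall_mem_insert, Finset.mem_singleton, forall_eq]; exact ⟨han _, hor _⟩
  | bb bb =>
    simp only [vlSrcs, Finset.forall_mem_insert, Finset.mem_singleton, forall_eq]
    exact ⟨own _ _ (by simp only [vlLvl]; omega), own _ _ (by simp only [vlLvl]; omega)⟩
  | bit bb =>
    simp only [vlSrcs]
    split_ifs
    · simp only [Finset.forall_mem_insert]
      refine ⟨own _ _ (by simp only [vlLvl]; omega), ?_⟩
      split
      · split_ifs
        · simp only [Finset.forall_mem_image]
          exact fun u _ => pre_valW L _ u _ (by simp only [Fin.val_last]; omega)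
        · simp only [Finset.mem_singleton, forall_eq]; exact hff
      · simp only [Finset.mem_singleton, forall_eq]; exact hff
    · simp only [Finset.forall_mem_insert, Finset.mem_singleton, forall_eq]
      exact ⟨own _ _ (by simp only [vlLvl]; omega), own _ _ (by simp only [vlLvl]; omega)⟩

end WCanon.R2c

end Summit.PneNP.PneNP.Theorems
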